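import Mathlib
import Summits.Ventures.HodgeRepro.Tier4.Common.TargetData
import Summits.Ventures.HodgeRepro.Tier4.Common.Geometry
import Summits.Ventures.HodgeRepro.Tier4.Common.Tower

/-!
# Tier4/Common/TargetBridge — from the abstract sentence `Witness.P` to the frozen `P_T4`: a realisation of the
witness on the target's datum carries (P) to the conclusion of `P_T4`

Blind re-derivation cell `pub-hodge-repro`, Tier 4 (README §9–§10), seat t4-typer-1 (gen 0).  Target tree path
`lean/Summits/Ventures/HodgeRepro/Tier4/Common/TargetBridge.lean`.  Imports `Tier4/Common/TargetData.lean` (the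
frozen `P_T4` as «∀ F E, ∀ d : TargetData F E, d.conclusion», with `d.jacS`, `d.jacSbar`, `d.pairing`,
`d.IsLevel`, `d.IsHeckeFor`, `d.IsDomain`) and `Tier4/Common/Geometry.lean` (`Witness`, `Witness.P`).

WHY.  The lines L1–L3 are written on the abstract datum of `Geometry.lean` (`W : Witness A`: the forms of `X`, the
Hecke translates, the four corner forms, `W.P` = «for some translates ⟨f^*Ω_s, f^*Ω_{s̄}⟩ ≠ 0»).  The frozen target
is concrete: Albanese lifts `a_i` on the ball, Hecke elements of a level `Γ′ ≤ Γ`, the coefficient functions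
`jac_s = d.jacS h`, `jac_{s̄} = d.jacSbar h` of `f^*Ω_s`, `f^*Ω_{s̄}` and the integral `∫_D jac_s · conj jac_{s̄}`.
A REALISATION of `W` on the datum `d` names the dictionary between the two: the level `Γ′` and the domain `D` at
which `W` lives, the concrete Hecke element `toHecke T` of each abstract translate, the coefficient function
`coeff2 β` of each abstract `2`-form on `dz₀ ∧ dz₁`, the fact that the abstract pairing of `2`-forms IS the integral
of the coefficients over `D`, and that the coefficients of `f^*Ω_s`, `f^*Ω_{s̄}` for the abstract translates `γ` are
`d.jacS`, `d.jacSbar` for the Hecke elements `toHecke ∘ γ` (re-indexed from the labelling `0,1 ∣ 2,3` of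
`Geometry.lean` to the corners `i₁, i₂ ∣ i₃, i₄` of the datum by `heckeOf`; the four corners are pairwise distinct
because a CM type never contains both `s` and `s̄` — `i₁_ne_i₃` etc., proved from `IsRankFourFace`).

WHAT IS PROVED.  `Realisation.conclusion_of_P : W.P → d.conclusion` — a line that proves `W.P` for a witness
realised on `d` proves the conclusion of `P_T4` for `d`; `P_T4_of_realised`: if every datum carries a realised
witness with (P), then `P_T4`; and, for the TOWER reading (`Tier4/Common/Tower.lean`), `Tower.conclusion_of_P`: a
tower whose every level is realised on `d` carries `Tower.P` to `d.conclusion` (`d.Levels` = the congruence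
subgroups `Γ′ ≤ Γ` ordered by inclusion is the natural level type).  The EXISTENCE of a realisation for a given datum (the holomorphic forms of the
compact quotient as a finite-dimensional space with its positive-definite `L²` pairing, the corner forms as the
differentials of the Albanese lifts, the Hecke algebra acting) is NOT proved here: it is the textbook content a
line must supply or display as a hypothesis of its lemma (README §9: listed in INPUTS.md).

Nothing here says anything about the status of the Hodge conjecture for CM abelian varieties, which is NOT proved
(HC_CM is NOT proved by anyone in this repository).
-/

set_option autoImplicit false

noncomputable section

open Matrix MeasureTheory NumberField
open scoped ComplexConjugate ComplexOrder

namespace Summit.Ventures.HodgeRepro.Tier4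

open Summit.Ventures.HodgeRepro.Tier4.Common

namespace TargetData

variable {F E : Type} [Field F] [NumberField F] [IsGalois ℚ F] [IsCMField F]
  [Field E] [NumberField E] [IsGalois ℚ E] [IsCMField E] (d : TargetData F E)

/-- The corners containing `s` are distinct from those containing `s̄`: a CM type contains `s` or `s̄`, never both. -/
theorem i₁_ne_i₃ : d.i₁ ≠ d.i₃ := by
  intro h
  have h1 := (d.hT.1 d.i₁ d.s).1 d.hs₁
  rw [h] at h1
  exact h1 d.hs₃

/-- `i₁ ≠ i₄`. -/
theorem i₁_ne_i₄ : d.i₁ ≠ d.i₄ := by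
  intro h
  have h1 := (d.hT.1 d.i₁ d.s).1 d.hs₁
  rw [h] at h1
  exact h1 d.hs₄

/-- `i₂ ≠ i₃`. -/
theorem i₂_ne_i₃ : d.i₂ ≠ d.i₃ := by
  intro h
  have h1 := (d.hT.1 d.i₂ d.s).1 d.hs₂
  rw [h] at h1
  exact h1 d.hs₃

/-- `i₂ ≠ i₄`. -/
theorem i₂_ne_i₄ : d.i₂ ≠ d.i₄ := by
  intro h
  have h1 := (d.hT.1 d.i₂ d.s).1 d.hs₂
  rw [h] at h1
  exact h1 d.hs₄

/-- **Re-indexing of the translates**: from the labelling `0, 1 ∣ 2, 3` of `Geometry.lean` (the two corners containing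
`s`, then the two containing `s̄`) to the corners `i₁, i₂ ∣ i₃, i₄` of the datum: `heckeOf t (i₁) = t 0`,
`heckeOf t (i₂) = t 1`, `heckeOf t (i₃) = t 2`, `heckeOf t (i₄) = t 3`. -/
def heckeOf (t : Fin 4 → HeckeElement E) : Fin 4 → HeckeElement E :=
  fun i => if i = d.i₁ then t 0 else if i = d.i₂ then t 1 else if i = d.i₃ then t 2 else t 3

/-- `heckeOf t i₁ = t 0`. -/
theorem heckeOf_i₁ (t : Fin 4 → HeckeElement E) : d.heckeOf t d.i₁ = t 0 := by
  simp [heckeOf]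

/-- `heckeOf t i₂ = t 1`. -/
theorem heckeOf_i₂ (t : Fin 4 → HeckeElement E) : d.heckeOf t d.i₂ = t 1 := by
  simp [heckeOf, d.h12.symm]

/-- `heckeOf t i₃ = t 2`. -/
theorem heckeOf_i₃ (t : Fin 4 → HeckeElement E) : d.heckeOf t d.i₃ = t 2 := by
  simp [heckeOf, d.i₁_ne_i₃.symm, d.i₂_ne_i₃.symm]

/-- `heckeOf t i₄ = t 3`. -/
theorem heckeOf_i₄ (t : Fin 4 → HeckeElement E) : d.heckeOf t d.i₄ = t 3 := by
  simp [heckeOf, d.i₁_ne_i₄.symm, d.i₂_ne_i₄.symm, d.h34.symm]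

/-- Every value of `heckeOf t` is a value of `t`. -/
theorem heckeOf_mem (t : Fin 4 → HeckeElement E) (i : Fin 4) : ∃ j : Fin 4, d.heckeOf t i = t j := by
  unfold heckeOf
  by_cases h1 : i = d.i₁
  · exact ⟨0, by simp [h1]⟩
  by_cases h2 : i = d.i₂
  · subst h2
    exact ⟨1, by simp [d.h12.symm]⟩
  by_cases h3 : i = d.i₃
  · subst h3
    exact ⟨2, by simp [d.i₁_ne_i₃.symm, d.i₂_ne_i₃.symm]⟩
  exact ⟨3, by simp [h1, h2, h3]⟩

end TargetData

/-- **A realisation of an abstract witness on the datum of `P_T4`**: the level and the fundamental domain, the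
concrete Hecke element of each abstract translate, the coefficient function of each abstract `2`-form, the
pairing as the integral over `D`, and the coefficients of `f^*Ω_s`, `f^*Ω_{s̄}` as the target's `jac_s`, `jac_{s̄}`. -/
structure Realisation {F E : Type} [Field F] [NumberField F] [IsGalois ℚ F] [IsCMField F]
    [Field E] [NumberField E] [IsGalois ℚ E] [IsCMField E] (d : TargetData F E)
    {Form : Type} [AddCommGroup Form] [Module ℂ Form] {A : FormAlgebra Form} (W : Witness A) where
  /-- the level `Γ′ ≤ Γ` of the witness -/
  Γ' : Set (Matrix (Fin 3) (Fin 3) E)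
  /-- `Γ′` is a congruence subgroup contained in `Γ` -/
  hΓ' : d.IsLevel Γ'
  /-- the fundamental domain `D` of `Γ′` -/
  D : Set (Fin 2 → ℂ)
  /-- `D` is a fundamental domain for the ball action of `Γ′` -/
  hD : d.IsDomain Γ' D
  /-- the Hecke element of level `Γ′` realising the abstract translate `T` -/
  toHecke : W.Hecke → HeckeElement E
  /-- it is of level `Γ′` -/
  toHecke_for : ∀ T : W.Hecke, (toHecke T).IsFor (conjE E) d.H Γ'
  /-- the coefficient function on `dz₀ ∧ dz₁` of an abstract `2`-form -/
  coeff2 : Form →ₗ[ℂ] ((Fin 2 → ℂ) → ℂ)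
  /-- the abstract `L²` pairing of `2`-forms is the integral of the coefficients over `D` -/
  hodge_eq : ∀ α β : Form, α ∈ A.H20 → β ∈ A.H20 →
    A.hodge α β = ∫ z in D, coeff2 α z * conj (coeff2 β z)
  /-- the coefficient of `f^*Ω_s` for the abstract translates `γ` is the target's `jac_s` for `toHecke ∘ γ` -/
  coeff_pullOmegaS : ∀ γ : W.Translates,
    coeff2 (W.pullOmegaS γ) = d.jacS (d.heckeOf fun j => toHecke (γ j))
  /-- the coefficient of `f^*Ω_{s̄}` for the abstract translates `γ` is the target's `jac_{s̄}` for `toHecke ∘ γ` -/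
  coeff_pullOmegaSbar : ∀ γ : W.Translates,
    coeff2 (W.pullOmegaSbar γ) = d.jacSbar (d.heckeOf fun j => toHecke (γ j))

namespace Realisation

variable {F E : Type} [Field F] [NumberField F] [IsGalois ℚ F] [IsCMField F]
  [Field E] [NumberField E] [IsGalois ℚ E] [IsCMField E] {d : TargetData F E}
  {Form : Type} [AddCommGroup Form] [Module ℂ Form] {A : FormAlgebra Form} {W : Witness A}

/-- The re-indexed Hecke elements of a realised choice of translates are of level `Γ′`. -/
theorem isHeckeFor_heckeOf (R : Realisation d W) (γ : W.Translates) :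
    d.IsHeckeFor R.Γ' (d.heckeOf fun j => R.toHecke (γ j)) := by
  intro i
  obtain ⟨j, hj⟩ := d.heckeOf_mem (fun j => R.toHecke (γ j)) i
  rw [hj]
  exact R.toHecke_for (γ j)

/-- The abstract Hodge pairing of (P) for the translates `γ` is the target's pairing for `toHecke ∘ γ`. -/
theorem hodgePairing_eq (R : Realisation d W) (γ : W.Translates) :
    W.hodgePairing γ = d.pairing R.D (d.heckeOf fun j => R.toHecke (γ j)) := by
  unfold Witness.hodgePairing TargetData.pairing
  rw [R.hodge_eq _ _ (W.pullOmegaS_mem γ) (W.pullOmegaSbar_mem γ), R.coeff_pullOmegaS γ,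
    R.coeff_pullOmegaSbar γ]

/-- **THE BRIDGE**: (P) for a witness realised on the datum `d` gives the conclusion of `P_T4` for `d`. -/
theorem conclusion_of_P (R : Realisation d W) (hP : W.P) : d.conclusion := by
  obtain ⟨γ, hγ⟩ := hP
  refine d.conclusion_of R.Γ' R.hΓ' (d.heckeOf fun j => R.toHecke (γ j)) (R.isHeckeFor_heckeOf γ) R.D R.hD ?_
  rw [← R.hodgePairing_eq γ]
  exact hγ

end Realisation

/-- **The levels of the datum**: the congruence subgroups `Γ′ ≤ Γ`, ordered by inclusion (`Γ″ ≤ Γ′` = the deeper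
level — the convention of `Tower`: `K′ ≤ K` means `X_{K′}` covers `X_K`). -/
abbrev TargetData.Levels {F E : Type} [Field F] [NumberField F] [IsGalois ℚ F] [IsCMField F]
    [Field E] [NumberField E] [IsGalois ℚ E] [IsCMField E] (d : TargetData F E) : Type :=
  {Γ' : Set (Matrix (Fin 3) (Fin 3) E) // d.IsLevel Γ'}

/-- **The tower bridge**: a tower every level of which is realised on the datum `d` carries (P) on the tower
(some level, some translates of that level) to the conclusion of `P_T4` for `d`. -/
theorem Tower.conclusion_of_P {F E : Type} [Field F] [NumberField F] [IsGalois ℚ F] [IsCMField F]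
    [Field E] [NumberField E] [IsGalois ℚ E] [IsCMField E] {d : TargetData F E}
    {Level : Type} [Preorder Level] {Form : Level → Type} [∀ K, AddCommGroup (Form K)]
    [∀ K, Module ℂ (Form K)] (𝒯 : Tower Level Form) (R : ∀ K : Level, Realisation d (𝒯.witness K))
    (hP : 𝒯.P) : d.conclusion := by
  obtain ⟨K, hK⟩ := hP
  exact (R K).conclusion_of_P hK

/-- **`P_T4` from realised witnesses**: if every datum `d` carries a witness, realised on `d`, for which (P) holds,
then `P_T4`. -/
theorem P_T4_of_realised
    (h : ∀ (F E : Type) [Field F] [NumberField F] [IsGalois ℚ F] [IsCMField F]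
      [Field E] [NumberField E] [IsGalois ℚ E] [IsCMField E] (d : TargetData F E),
      ∃ (Form : Type) (_ : AddCommGroup Form) (_ : Module ℂ Form) (A : FormAlgebra Form)
        (W : Witness A) (_ : Realisation d W), W.P) : P_T4 := by
  refine P_T4_of_forall fun F E _ _ _ _ _ _ _ _ d => ?_
  obtain ⟨Form, _, _, A, W, R, hP⟩ := h F E d
  exact R.conclusion_of_P hP

end Summit.Ventures.HodgeRepro.Tier4
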